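import Summits.KontsevichZagierPeriods.KontsevichZagierPeriods.Theorems.HurwitzSectorComplement.Negative.Core

/-!
# Crux `HurwitzSectorComplement` (stmt-KontsevichZagierPeriods-14341), line `chebyshev-level-deformation`:
# the splice stub S6 `stub_spliceRemainder` IS the summit (given the parity tower sector)

The registered stub S6 of the lead skeleton `Cruxes/HurwitzSectorComplement/Lines/chebyshev_level_deformation.lean`
reads `stub_spliceRemainder : ParityTowerSector → NormalFormPrinciple`, where `ParityTowerSector` (written out
verbatim below, exactly as registered) is the conclusion of S5 `stub_assembly` — Conjecture 1 of Kontsevich–Zagier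
on the real-algebraic span of the symmetric Hurwitz tower — and `NormalFormPrinciple` is the route target.

Since `NormalFormPrinciple ↔ KontsevichZagierPeriods` is a tree theorem
(`HurwitzSectorComplement.Negative.nfp_iff_statement`: `→` is the route's deciding theorem `closes`,
`←` takes `𝒩 :=` the rational representations), the S6 signature is sandwiched by the summit:

* `stub_spliceRemainder_of_statement : KontsevichZagierPeriods → S6` (the hypothesis is idle);
* `stub_spliceRemainder_iff : S6 ↔ (ParityTowerSector → KontsevichZagierPeriods)` (`.mp`: S6 and the parity
  tower sector together give the summit).

So once the line's composition `parityTowerSector` (S1–S5) is a theorem, S6 is literally equivalent to the summit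
statement `KontsevichZagierPeriods` (Conjecture 1 of [KontsevichZagier2001, §1.2] for the fixed H21 calculus
`KZ.relations`): no proof of S6 exists short of a proof of Conjecture 1, and no refutation short of a disproof of it.
This file records that fact kernel-checked against the exact registered signature; it asserts no route item.

References: M. Kontsevich, D. Zagier, *Periods* (2001), §1.2, Conjecture 1.
-/

namespace Summit.KontsevichZagierPeriods.Theorems.HurwitzMicroSectorsHurwitzSectorComplement

open Literature.NumberTheory.Transcendental
open Summit.KontsevichZagierPeriods.KontsevichZagierPeriods.Theses.HurwitzMicroSectors (NormalFormPrinciple)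
open Summit.KontsevichZagierPeriods.Theorems.HurwitzSectorComplement.Negative (nfp_iff_statement)

/-- **The summit implies S6** (its hypothesis, the parity tower sector, is idle): from Conjecture 1 for the H21
calculus, `NormalFormPrinciple` holds with `𝒩 :=` the rational representations (`nfp_iff_statement.mpr`).
The displayed hypothesis is the registered `ParityTowerSector` signature of the line, verbatim.
[cite: KontsevichZagier2001, §1.2 Conjecture 1] -/
theorem stub_spliceRemainder_of_statement (h : KontsevichZagierPeriods) :
    (∀ (w N w' N' : ℕ), 2 ≤ w → 1 ≤ N → 2 ≤ w' → 1 ≤ N' →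
      ∀ (r : KZ.IntegralRep w) (r' : KZ.IntegralRep w'),
      (∃ (Q R : Polynomial ℝ), (∀ i, IsAlgebraic ℚ (Q.coeff i)) ∧ (∀ i, IsAlgebraic ℚ (R.coeff i)) ∧
        R.natDegree < N ∧ (∀ i j : ℕ, i + j + 2 = N → R.coeff i = (-1 : ℝ) ^ w * R.coeff j) ∧
        (Odd w → R.coeff (N - 1) = 0) ∧ r.domain = {x | ∀ i, x i ∈ Set.Ioo (0:ℝ) 1} ∧
        Set.EqOn r.integrand (fun x => Polynomial.eval (∏ i, x i) Q +
          Polynomial.eval (∏ i, x i) R / (1 - (∏ i, x i) ^ N)) r.domain) →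
      (∃ (Q R : Polynomial ℝ), (∀ i, IsAlgebraic ℚ (Q.coeff i)) ∧ (∀ i, IsAlgebraic ℚ (R.coeff i)) ∧
        R.natDegree < N' ∧ (∀ i j : ℕ, i + j + 2 = N' → R.coeff i = (-1 : ℝ) ^ w' * R.coeff j) ∧
        (Odd w' → R.coeff (N' - 1) = 0) ∧ r'.domain = {x | ∀ i, x i ∈ Set.Ioo (0:ℝ) 1} ∧
        Set.EqOn r'.integrand (fun x => Polynomial.eval (∏ i, x i) Q +
          Polynomial.eval (∏ i, x i) R / (1 - (∏ i, x i) ^ N')) r'.domain) →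
      r.value = r'.value → KZ.Equivalent r r') →
    NormalFormPrinciple :=
  fun _ => nfp_iff_statement.mpr h

/-- **S6 is exactly "the parity tower sector implies the summit"**: the registered signature of
`stub_spliceRemainder` is equivalent to `ParityTowerSector → KontsevichZagierPeriods` (`.mp`: S6 yields
`NormalFormPrinciple`, which is the statement by the route's deciding theorem `closes`; `.mpr`: the summit gives
`NormalFormPrinciple` with `𝒩 :=` the rational representations). With `ParityTowerSector` the theorem the line
composes from S1–S5, S6 is therefore equivalent to Conjecture 1 of Kontsevich–Zagier for the H21 calculus itself —
summit-strength, neither provable nor refutable short of settling the summit; in particular `.mp` says that landing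
S6 after `parityTowerSector` would close the summit. [cite: KontsevichZagier2001, §1.2 Conjecture 1] -/
theorem stub_spliceRemainder_iff :
    ((∀ (w N w' N' : ℕ), 2 ≤ w → 1 ≤ N → 2 ≤ w' → 1 ≤ N' →
      ∀ (r : KZ.IntegralRep w) (r' : KZ.IntegralRep w'),
      (∃ (Q R : Polynomial ℝ), (∀ i, IsAlgebraic ℚ (Q.coeff i)) ∧ (∀ i, IsAlgebraic ℚ (R.coeff i)) ∧
        R.natDegree < N ∧ (∀ i j : ℕ, i + j + 2 = N → R.coeff i = (-1 : ℝ) ^ w * R.coeff j) ∧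
        (Odd w → R.coeff (N - 1) = 0) ∧ r.domain = {x | ∀ i, x i ∈ Set.Ioo (0:ℝ) 1} ∧
        Set.EqOn r.integrand (fun x => Polynomial.eval (∏ i, x i) Q +
          Polynomial.eval (∏ i, x i) R / (1 - (∏ i, x i) ^ N)) r.domain) →
      (∃ (Q R : Polynomial ℝ), (∀ i, IsAlgebraic ℚ (Q.coeff i)) ∧ (∀ i, IsAlgebraic ℚ (R.coeff i)) ∧
        R.natDegree < N' ∧ (∀ i j : ℕ, i + j + 2 = N' → R.coeff i = (-1 : ℝ) ^ w' * R.coeff j) ∧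
        (Odd w' → R.coeff (N' - 1) = 0) ∧ r'.domain = {x | ∀ i, x i ∈ Set.Ioo (0:ℝ) 1} ∧
        Set.EqOn r'.integrand (fun x => Polynomial.eval (∏ i, x i) Q +
          Polynomial.eval (∏ i, x i) R / (1 - (∏ i, x i) ^ N')) r'.domain) →
      r.value = r'.value → KZ.Equivalent r r') →
    NormalFormPrinciple) ↔
    ((∀ (w N w' N' : ℕ), 2 ≤ w → 1 ≤ N → 2 ≤ w' → 1 ≤ N' →
      ∀ (r : KZ.IntegralRep w) (r' : KZ.IntegralRep w'),
      (∃ (Q R : Polynomial ℝ), (∀ i, IsAlgebraic ℚ (Q.coeff i)) ∧ (∀ i, IsAlgebraic ℚ (R.coeff i)) ∧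
        R.natDegree < N ∧ (∀ i j : ℕ, i + j + 2 = N → R.coeff i = (-1 : ℝ) ^ w * R.coeff j) ∧
        (Odd w → R.coeff (N - 1) = 0) ∧ r.domain = {x | ∀ i, x i ∈ Set.Ioo (0:ℝ) 1} ∧
        Set.EqOn r.integrand (fun x => Polynomial.eval (∏ i, x i) Q +
          Polynomial.eval (∏ i, x i) R / (1 - (∏ i, x i) ^ N)) r.domain) →
      (∃ (Q R : Polynomial ℝ), (∀ i, IsAlgebraic ℚ (Q.coeff i)) ∧ (∀ i, IsAlgebraic ℚ (R.coeff i)) ∧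
        R.natDegree < N' ∧ (∀ i j : ℕ, i + j + 2 = N' → R.coeff i = (-1 : ℝ) ^ w' * R.coeff j) ∧
        (Odd w' → R.coeff (N' - 1) = 0) ∧ r'.domain = {x | ∀ i, x i ∈ Set.Ioo (0:ℝ) 1} ∧
        Set.EqOn r'.integrand (fun x => Polynomial.eval (∏ i, x i) Q +
          Polynomial.eval (∏ i, x i) R / (1 - (∏ i, x i) ^ N')) r'.domain) →
      r.value = r'.value → KZ.Equivalent r r') →
    KontsevichZagierPeriods) :=
  ⟨fun h6 hPTS => nfp_iff_statement.mp (h6 hPTS), fun h hPTS => nfp_iff_statement.mpr (h hPTS)⟩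

end Summit.KontsevichZagierPeriods.Theorems.HurwitzMicroSectorsHurwitzSectorComplement
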